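/-
Copyright: public-domain mathematics; typed transcription for the H21 Literature library (cell lit-balaban,
Phase-2 proof seat p38 gen 7 = literature-prover-lit-balaban-p38-g7-0).

statement-level skeleton of published theorems with citation tags; proofs where landed; nothing here is a claim about the Yang–Mills mass gap

# Bałaban, *Propagators and renormalization transformations for lattice gauge theories. I*,
# Commun. Math. Phys. **95** (1984) 17–40 — the cube cover `□_z` and the partition of unity `h_z` of (1.118) AT SCALE `M₀`
# on the torus of record `T_η = Tor (fine n M)`, with the geometry the random walk (1.123)–(1.131) consumes

[cite: Balaban1984PropagatorsI]  T. Bałaban, Commun. Math. Phys. 95 (1984) 17–40.  p. 36 (PDF p. 20), verbatim (OCR layer of the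
held scan `paper:balaban1984-cmp95-propagators-rt-i`, p0020, ll. 25–32): «Instead we construct a random walk representation of the
kind described in [2]. Such representations will be our basic tool in investigation of more complicated operators. We consider the
lattice of cubes of size M₀, M₀ = L^{m₀}, defined by the lattice T^{(k+m₀)}_{M₀}, and cubes □_z of size 2M₀ and with a center at the
point z ∈ T^{(k+m₀)}_{M₀}. These cubes cover the lattice T_η. We construct a partition of unity taking the functions
[h_z(x) = Π_{μ=1}^d h((x_μ − z_μ)/M₀), h ∈ C₀^∞(]−⅔, ⅔[) — display, reconstructed from the formula layer] h(t) = 1 for t ∈ [−⅓, ⅓],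
h is chosen in such a way that Σ_n h²(t − n) = 1, hence Σ_z h_z²(x) = 1. (1.118)»; p. 38 [PDF 22]: «(1.126) gives a bound with a small
factor O(M₀⁻¹) and the exponential factor e^{−⅓δ′₀M₀|z′₁−z′₂|} … Defining 2δ₀ = min{⅓δ′₀, M₀⁻¹}, we obtain
|h_{z₁}K(h_{z₂})A| ≤ O(M₀⁻¹)e^{−2δ₀|z₁−z₂|}(|∇A| + |A|). (1.128)»; p. 37 (1.121) (the terms «Σ_b (∂h)(b)(∂A)(b)», «(Δh)A» of K(h));
p. 39 [PDF 23]: «Let us notice that the constant O(1) under the sum above is an absolute constant depending on d only, hence we can fix M₀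
depending on d only, such that the series is convergent.»

WHAT THIS MODULE ADDS (SKELETON rows B5.Eq1.118–B5.Eq1.131 / B5.Prop1.2, owner r02; GAPS G-B5-03 = the printed RANDOM-WALK route
for G, so far un-inhabited on the torus — see `B5Local114.Realisation`, pub-balaban B05 gen 4).  The abstract walk machine
`B5Local114` needs, per instance and cube scale `M₀ ≥ 1`: a pseudometric carrier `X` ⊇ `T_η` dominating the unit-lattice distance,
finitely many centres `z` with points `ctr z ∈ X`, real multipliers `h_z` with `Σ_z h_z² = 1`, `|h_z| ≤ 1`, supports of radius
`O(M₀)`, Lipschitz constant `O(M₀⁻¹)` and lattice Laplacian `O(M₀⁻²)` (the data behind `∂h = O(M₀⁻¹)` (the «small factor O(M₀⁻¹)» of (1.128)), (1.121)/(1.128)), at most `ν`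
cubes through a point and the row sums «Σ_{z′} e^{−δ₀|z−z′|}» bounded uniformly.  We CONSTRUCT them for r02's torus of record
`Tor (fine n M)` (`η = 1/n`, unit periods `M_μ`) at EVERY `M₀ ≥ 1` and EVERY torus, with constants depending on `d` only:
* (carrier, centres `Cen M M₀`, spacing `sp`, centre points `ctr`, multiplicity and row sums: the companion module `B5WalkTorusGeom`);
* THE PARTITION OF UNITY `hz z u = Π_μ h_per(u_μ/sp μ − z_μ)` with THE PRINTED PROFILE `h` (`B4PartitionUnity22.hprof`, periodised
  `B5Partition118Printed.hper`): `Σ_z (hz z u)² = 1` for EVERY `u ∈ TorR M` (1.118) (`sum_hz_sq`), `0 ≤ hz ≤ 1`, SUPPORT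
  `hz z u ≠ 0 ⇒ dist u (ctr z) ≤ ⅔M₀` (`dist_ctr_le_of_hz_ne_zero`), LIPSCHITZ `|hz z u − hz z v| ≤ (Lw(d)/M₀)·dist u v`
  (`abs_hz_sub_le`, `Lw d = 2d·max(sup|h′|, 8)` r02's constant) and the SECOND DIFFERENCES along an axis
  `|hz z (u + te_μ) − 2hz z u + hz z (u − te_μ)| ≤ (4·max(sup|h″|,15)/M₀²)·t²` (`abs_hz_second_diff_le`) — `∂h = O(M₀⁻¹)` (the «small factor O(M₀⁻¹)» of (1.128)),
  `Δh = O(M₀⁻²)` of (1.121)/(1.128), uniformly in the torus, `η`, `M₀ ≥ 1`.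
Consumers: `B5WalkCarrierTorus` / `B5WalkH128Torus` / `B5WalkRealisationTorus` (this seat), which inhabit `B5Local114.Realisation` for
`B5SettingP12Real.latticeSettingP12R`.

HONEST SCOPE.  Lattice geometry only; no operator of the paper enters.  Constants ours (the paper prints O(1)'s).  DEVIATION (forced by
the interface `∀ M₀ ≥ 1`, every torus): centre spacing `M_μ/⌈M_μ/M₀⌉ ∈ [M₀/2, M₀]` instead of exactly `M₀`; equal to the print when
`M₀ ∣ M_μ`.  value = located leaves (1.118) + p. 36/38 cube geometry for the torus of record — NOT summit progress.
-/
import Mathlib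
import Literature.MathematicalPhysics.QuantumFieldTheory.Balaban1983to89.B5WalkTorusGeom

open scoped BigOperators Real
open Finset

namespace Literature.MathematicalPhysics.QuantumFieldTheory.Balaban1983to89.B5WalkPartitionTorus

open Literature.MathematicalPhysics.QuantumFieldTheory.Balaban1983to89
open Literature.MathematicalPhysics.QuantumFieldTheory.Balaban1983to89.B5Prop11Plancherel (Tor fine)
open Literature.MathematicalPhysics.QuantumFieldTheory.Balaban1983to89.B5Prop12FieldsLattice (cdistF distU distSite toFine cubeT
  distU_nonneg)
open Literature.MathematicalPhysics.QuantumFieldTheory.Balaban1983to89.B4TorusKernel.MultiPeriod (circAbs circAbs_nonneg)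
open Literature.MathematicalPhysics.QuantumFieldTheory.Balaban1983to89.B4Sect5Torus (TSite ccoord tdist ccoord_cast circAbs_zero)
open Literature.MathematicalPhysics.QuantumFieldTheory.Balaban1983to89.B4Sect5Proof (latticeConst latticeConst_nonneg)
open Literature.MathematicalPhysics.QuantumFieldTheory.Balaban1983to89.B5TorusCover (rowSum_finset_le ballCard_le_real)
open Literature.MathematicalPhysics.QuantumFieldTheory.Balaban1983to89.B4PartitionUnity22 (hprof hprof_nonneg hprof_le_one
  contDiff_hprof hasCompactSupport_hprof D1 D2 D1_nonneg D2_nonneg abs_second_diff_le_D2)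
open Literature.MathematicalPhysics.QuantumFieldTheory.Balaban1983to89.B5Partition118Printed (crep abs_crep_le abs_crep_le_abs_sub
  crep_eq_sub crep_add_int_mul crep_eq_self hper hper_nonneg hper_le_one hper_eq_zero hper_local sum_hper_sq natMul_abs_crep_eq_circAbs)
open Literature.MathematicalPhysics.QuantumFieldTheory.Balaban1983to89.B5CoverP12Lattice (ProfileData profileData_hprof per hper_eq_per
  per_lipschitz abs_crep_add_le abs_crep_neg abs_crep_le_abs abs_prod_sub_prod_le uc cdistF_eq_mul_abs_crep cdistF_le_mul_distU
  abs_crep_uc_sub_le_distU mem_cubeT_iff_crep Lw Lw_nonneg)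
open Literature.MathematicalPhysics.QuantumFieldTheory.Balaban1983to89.B5Ineq110P12Lattice (natAbs_valMinAbs_intCast_sub)
open Literature.MathematicalPhysics.QuantumFieldTheory.Balaban1983to89.B6Cov2156Torus (one_le_M)
open Literature.MathematicalPhysics.QuantumFieldTheory.Balaban1983to89.B5WalkTorusGeom

noncomputable section

variable {d : ℕ}

/-! ## The partition of unity `h_z` of (1.118) at scale `M₀` on the real torus -/

section Partition

open TorR

variable (M : Fin d → ℕ) [hM : ∀ μ, NeZero (M μ)] (M₀ : ℕ)

omit hM in
/-- **the profile on the axis `μ`**: the periodised printed profile `h` of (1.118) over the `nCtr_μ` centres (argument in units of the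
spacing), or the constant `1` when the axis carries a single centre. [cite: Balaban1984PropagatorsI, (1.118) p.36] -/
def prof (μ : Fin d) (t : ℝ) : ℝ := if 2 ≤ nCtr M M₀ μ then hper (nCtr M M₀ μ) t else 1

omit hM in
/-- `0 ≤ prof`. [cite: Balaban1984PropagatorsI, (1.118) p.36] -/
theorem prof_nonneg (μ : Fin d) (t : ℝ) : 0 ≤ prof M M₀ μ t := by
  unfold prof; split_ifs
  · exact hper_nonneg _ _
  · exact zero_le_one

omit hM in
/-- `prof ≤ 1`. [cite: Balaban1984PropagatorsI, (1.118) p.36] -/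
theorem prof_le_one (μ : Fin d) (t : ℝ) : prof M M₀ μ t ≤ 1 := by
  unfold prof; split_ifs
  · exact hper_le_one _ _
  · exact le_rfl

/-- **`h_z(u) = Π_μ h((u_μ − z_μ·sp_μ)/sp_μ)`** — the function (1.118) «h_z(x) = Π_{μ=1}^d h((x_μ − z_μ)/M₀)» on the real torus
(spacing `sp_μ = M₀` in the printed situation `M₀ ∣ M_μ`). [cite: Balaban1984PropagatorsI, (1.118) p.36] -/
def hz (z : Cen M M₀) (u : TorR M) : ℝ := ∏ μ, prof M M₀ μ (u.c μ / sp M M₀ μ - ((z μ).val : ℝ))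

omit hM in
/-- `0 ≤ h_z`. [cite: Balaban1984PropagatorsI, (1.118) p.36] -/
theorem hz_nonneg (z : Cen M M₀) (u : TorR M) : 0 ≤ hz M M₀ z u :=
  Finset.prod_nonneg fun μ _ => prof_nonneg M M₀ μ _

omit hM in
/-- `h_z ≤ 1`. [cite: Balaban1984PropagatorsI, (1.118) p.36] -/
theorem hz_le_one (z : Cen M M₀) (u : TorR M) : hz M M₀ z u ≤ 1 :=
  Finset.prod_le_one (fun μ _ => prof_nonneg M M₀ μ _) fun μ _ => prof_le_one M M₀ μ _

omit hM in
/-- `|h_z| ≤ 1`. [cite: Balaban1984PropagatorsI, (1.118) p.36] -/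
theorem abs_hz_le_one (z : Cen M M₀) (u : TorR M) : |hz M M₀ z u| ≤ 1 := by
  rw [abs_of_nonneg (hz_nonneg M M₀ z u)]; exact hz_le_one M M₀ z u

omit hM in
/-- per axis: `Σ_c prof(t − c)² = 1` over the centres of that axis. [cite: Balaban1984PropagatorsI, (1.118) p.36 («Σ_n h²(t − n) = 1»)] -/
theorem sum_prof_sq (μ : Fin d) (t : ℝ) : ∑ c : Fin (nCtr M M₀ μ), prof M M₀ μ (t - (c.val : ℝ)) ^ 2 = 1 := by
  unfold prof
  split_ifs with h2
  · exact sum_hper_sq h2 t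
  · have h1 : nCtr M M₀ μ = 1 := by have := one_le_nCtr M M₀ μ; omega
    rw [Finset.sum_const, Finset.card_univ, Fintype.card_fin, h1]
    simp

omit hM in
/-- **(1.118): `Σ_z h_z(u)² = 1` FOR EVERY POINT OF THE REAL TORUS**, every torus and every scale `M₀`.
[cite: Balaban1984PropagatorsI, (1.118) p.36 («hence Σ_z h_z²(x) = 1»)] -/
theorem sum_hz_sq (u : TorR M) : ∑ z : Cen M M₀, hz M M₀ z u ^ 2 = 1 := by
  unfold hz
  simp_rw [← Finset.prod_pow]
  rw [← Fintype.prod_sum (fun μ (c : Fin (nCtr M M₀ μ)) => prof M M₀ μ (u.c μ / sp M M₀ μ - (c.val : ℝ)) ^ 2)]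
  exact Finset.prod_eq_one fun μ _ => sum_prof_sq M M₀ μ _

/-- the argument of the `μ`-th factor, rescaled: `u_μ − z_μ·sp_μ = (u_μ/sp_μ − z_μ)·sp_μ`. [cite: Balaban1984PropagatorsI, (1.118) p.36] -/
theorem coord_sub_ctr (z : Cen M M₀) (u : TorR M) (μ : Fin d) :
    u.c μ - (ctr M M₀ z).c μ = (u.c μ / sp M M₀ μ - ((z μ).val : ℝ)) * sp M M₀ μ := by
  rw [ctr_c]
  have := (sp_pos M M₀ μ).ne'
  field_simp

/-- the circular distance of `u_μ` to the centre coordinate is the spacing times the circular distance of the rescaled argument: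
`|crep_{M_μ}(u_μ − z_μsp_μ)| = sp_μ·|crep_{nCtr_μ}(u_μ/sp_μ − z_μ)|`. [cite: Balaban1984PropagatorsI, (1.118) p.36] -/
theorem abs_crep_coord_sub_ctr (z : Cen M M₀) (u : TorR M) (μ : Fin d) :
    |crep (M μ) (u.c μ - (ctr M M₀ z).c μ)| = sp M M₀ μ * |crep (nCtr M M₀ μ) (u.c μ / sp M M₀ μ - ((z μ).val : ℝ))| := by
  rw [coord_sub_ctr, ← nCtr_mul_sp M M₀ μ, crep_mul_scale (sp_pos M M₀ μ), abs_mul, abs_of_pos (sp_pos M M₀ μ)]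

variable {M₀}

/-- **SUPPORT: `h_z(u) ≠ 0 ⇒ dist(u, ctr z) ≤ ⅔M₀`** («h ∈ C₀^∞(]−⅔, ⅔[)», cubes □_z of size 2M₀).
[cite: Balaban1984PropagatorsI, (1.118) p.36] -/
theorem dist_ctr_le_of_hz_ne_zero (hM₀ : 1 ≤ M₀) {z : Cen M M₀} {u : TorR M} (h : hz M M₀ z u ≠ 0) :
    dist u (ctr M M₀ z) ≤ 2 / 3 * M₀ := by
  have hM0 : (0 : ℝ) < M₀ := by exact_mod_cast hM₀
  refine dist_le_of_forall M (by positivity) fun μ => ?_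
  have hfac : prof M M₀ μ (u.c μ / sp M M₀ μ - ((z μ).val : ℝ)) ≠ 0 :=
    (Finset.prod_ne_zero_iff.mp h) μ (Finset.mem_univ μ)
  rw [abs_crep_coord_sub_ctr]
  unfold prof at hfac
  split_ifs at hfac with h2
  · have hlt : |crep (nCtr M M₀ μ) (u.c μ / sp M M₀ μ - ((z μ).val : ℝ))| < 2 / 3 := by
      by_contra hge
      exact hfac (hper_eq_zero (not_lt.mp hge))
    have hs := sp_le M hM₀ μ
    have hs0 := sp_pos M M₀ μ
    nlinarith
  · have h1 : nCtr M M₀ μ = 1 := by have := one_le_nCtr M M₀ μ; omega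
    have hP : (M μ : ℝ) ≤ M₀ := period_le_of_nCtr_eq_one M hM₀ h1
    have hb := abs_crep_le (nCtr_pos M M₀ μ) (u.c μ / sp M M₀ μ - ((z μ).val : ℝ))
    have hs0 := sp_pos M M₀ μ
    calc sp M M₀ μ * |crep (nCtr M M₀ μ) (u.c μ / sp M M₀ μ - ((z μ).val : ℝ))|
        ≤ sp M M₀ μ * ((nCtr M M₀ μ : ℝ) / 2) := mul_le_mul_of_nonneg_left hb hs0.le
      _ = (M μ : ℝ) / 2 := by rw [← nCtr_mul_sp M M₀ μ]; ring
      _ ≤ 2 / 3 * M₀ := by linarith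

omit hM in
/-- per axis, circular Lipschitz bound of the profile in units of the spacing: `|prof(a) − prof(b)| ≤ max(sup|h′|, 8)·|crep_{nCtr}(a − b)|`.
[cite: Balaban1984PropagatorsI, (1.118) p.36 with (1.121) p.37 («∂h»)] -/
theorem abs_prof_sub_le (μ : Fin d) (a b : ℝ) :
    |prof M M₀ μ a - prof M M₀ μ b| ≤ max (D1 hprof) 8 * |crep (nCtr M M₀ μ) (a - b)| := by
  unfold prof
  split_ifs with h2
  · rw [hper_eq_per, hper_eq_per]
    exact per_lipschitz profileData_hprof h2 a b
  · rw [sub_self, abs_zero]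
    exact mul_nonneg (le_max_of_le_right (by norm_num)) (abs_nonneg _)

/-- on an axis with at least two centres, the rescaled circular distance of two coordinates is at most `(2/M₀)·dist`
(spacing `≥ M₀/2`). [cite: Balaban1984PropagatorsI, (1.118) p.36, (1.109) p.35] -/
theorem abs_crep_rescaled_le (hM₀ : 1 ≤ M₀) {μ : Fin d} (h2 : 2 ≤ nCtr M M₀ μ) (u v : TorR M) :
    |crep (nCtr M M₀ μ) (u.c μ / sp M M₀ μ - v.c μ / sp M M₀ μ)| ≤ 2 / M₀ * dist u v := by
  have hM0 : (0 : ℝ) < M₀ := by exact_mod_cast hM₀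
  have hs0 := sp_pos M M₀ μ
  have e : |crep (M μ) (u.c μ - v.c μ)| = sp M M₀ μ * |crep (nCtr M M₀ μ) (u.c μ / sp M M₀ μ - v.c μ / sp M M₀ μ)| := by
    have e1 : u.c μ - v.c μ = (u.c μ / sp M M₀ μ - v.c μ / sp M M₀ μ) * sp M M₀ μ := by field_simp
    rw [e1, ← nCtr_mul_sp M M₀ μ, crep_mul_scale hs0, abs_mul, abs_of_pos hs0]
  have hd := abs_crep_sub_le_dist M u v μ
  rw [e] at hd
  have hs := half_le_sp M hM₀ h2
  have h3 : (M₀ : ℝ) / 2 * |crep (nCtr M M₀ μ) (u.c μ / sp M M₀ μ - v.c μ / sp M M₀ μ)|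
      ≤ sp M M₀ μ * |crep (nCtr M M₀ μ) (u.c μ / sp M M₀ μ - v.c μ / sp M M₀ μ)| :=
    mul_le_mul_of_nonneg_right hs (abs_nonneg _)
  rw [div_mul_eq_mul_div, le_div_iff₀ hM0]
  linarith

/-- **LIPSCHITZ: `|h_z(u) − h_z(v)| ≤ (Lw(d)/M₀)·dist(u, v)`** — `∂h = O(M₀⁻¹)` (the «small factor O(M₀⁻¹)» of (1.128)), the small factor of (1.128), uniformly in the torus and in
`M₀ ≥ 1` (`Lw d = 2d·max(sup|h′|, 8)`, r02's unit-scale constant). [cite: Balaban1984PropagatorsI, (1.118) p.36 with (1.121) p.37, (1.128) p.38] -/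
theorem abs_hz_sub_le (hM₀ : 1 ≤ M₀) (z : Cen M M₀) (u v : TorR M) :
    |hz M M₀ z u - hz M M₀ z v| ≤ Lw d / M₀ * dist u v := by
  have hM0 : (0 : ℝ) < M₀ := by exact_mod_cast hM₀
  have hK0 : (0 : ℝ) ≤ max (D1 hprof) 8 := le_max_of_le_right (by norm_num)
  unfold hz
  set a : Fin d → ℝ := fun μ => prof M M₀ μ (u.c μ / sp M M₀ μ - ((z μ).val : ℝ)) with ha
  set b : Fin d → ℝ := fun μ => prof M M₀ μ (v.c μ / sp M M₀ μ - ((z μ).val : ℝ)) with hb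
  have hMd : (0 : ℝ) ≤ 2 / M₀ * dist u v := by positivity
  have hfac : ∀ μ, |a μ - b μ| ≤ max (D1 hprof) 8 * (2 / M₀ * dist u v) := by
    intro μ
    rcases Nat.lt_or_ge (nCtr M M₀ μ) 2 with h1 | h2
    · have hc : ∀ s : ℝ, prof M M₀ μ s = 1 := fun s => by unfold prof; rw [if_neg (by omega)]
      have : a μ - b μ = 0 := by simp only [ha, hb, hc, sub_self]
      rw [this, abs_zero]
      exact mul_nonneg hK0 hMd
    · have h := abs_prof_sub_le M (M₀ := M₀) μ (u.c μ / sp M M₀ μ - ((z μ).val : ℝ)) (v.c μ / sp M M₀ μ - ((z μ).val : ℝ))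
      have e : u.c μ / sp M M₀ μ - ((z μ).val : ℝ) - (v.c μ / sp M M₀ μ - ((z μ).val : ℝ))
          = u.c μ / sp M M₀ μ - v.c μ / sp M M₀ μ := by ring
      rw [e] at h
      exact h.trans (mul_le_mul_of_nonneg_left (abs_crep_rescaled_le M hM₀ h2 u v) hK0)
  calc |∏ μ, a μ - ∏ μ, b μ| ≤ ∑ μ, |a μ - b μ| :=
        abs_prod_sub_prod_le Finset.univ a b (fun μ _ => prof_nonneg M M₀ μ _) (fun μ _ => prof_le_one M M₀ μ _)
          (fun μ _ => prof_nonneg M M₀ μ _) fun μ _ => prof_le_one M M₀ μ _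
    _ ≤ ∑ _μ : Fin d, max (D1 hprof) 8 * (2 / M₀ * dist u v) := Finset.sum_le_sum fun μ _ => hfac μ
    _ = Lw d / M₀ * dist u v := by
        rw [Finset.sum_const, Finset.card_univ, Fintype.card_fin, nsmul_eq_mul]
        have hM0' : (M₀ : ℝ) ≠ 0 := hM0.ne'
        unfold Lw
        field_simp

omit hM in
/-- per axis, second differences of the periodised profile: `|prof(a + τ) − 2prof(a) + prof(a − τ)| ≤ max(sup|h″|, 15)·τ²` — inside the
window `|τ| ≤ ⅜` by the local chart of `hper` and Taylor, outside it by `|·| ≤ 2 ≤ 15τ²`.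
[cite: Balaban1984PropagatorsI, (1.118) p.36 with (1.121) p.37 («(Δh)A»)] -/
theorem abs_prof_second_diff_le (μ : Fin d) (a τ : ℝ) :
    |prof M M₀ μ (a + τ) - 2 * prof M M₀ μ a + prof M M₀ μ (a - τ)| ≤ max (D2 hprof) 15 * τ ^ 2 := by
  unfold prof
  split_ifs with h2
  · by_cases hτ : |τ| ≤ 3 / 8
    · obtain ⟨m, hm⟩ := hper_local h2 a
      rw [hm (a + τ) (by rw [add_sub_cancel_left]; exact hτ), hm a (by rw [sub_self, abs_zero]; norm_num),
        hm (a - τ) (by rw [sub_sub_cancel_left, abs_neg]; exact hτ)]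
      have h := abs_second_diff_le_D2 contDiff_hprof hasCompactSupport_hprof (a - m * (nCtr M M₀ μ : ℕ)) τ
      rw [show a - (m : ℝ) * (nCtr M M₀ μ : ℕ) + τ = a + τ - m * (nCtr M M₀ μ : ℕ) by ring,
        show a - (m : ℝ) * (nCtr M M₀ μ : ℕ) - τ = a - τ - m * (nCtr M M₀ μ : ℕ) by ring] at h
      exact h.trans (mul_le_mul_of_nonneg_right (le_max_left _ _) (sq_nonneg τ))
    · rw [not_le] at hτ
      have h0 := hper_nonneg (nCtr M M₀ μ) (a + τ)
      have h1 := hper_le_one (nCtr M M₀ μ) (a + τ)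
      have h0' := hper_nonneg (nCtr M M₀ μ) a
      have h1' := hper_le_one (nCtr M M₀ μ) a
      have h0'' := hper_nonneg (nCtr M M₀ μ) (a - τ)
      have h1'' := hper_le_one (nCtr M M₀ μ) (a - τ)
      have hτ2 : (3 / 8 : ℝ) ^ 2 < τ ^ 2 := by
        have := sq_lt_sq' (by linarith [abs_nonneg τ]) hτ
        rwa [sq_abs] at this
      rw [abs_le]
      constructor
      · nlinarith [le_max_right (D2 hprof) 15]
      · nlinarith [le_max_right (D2 hprof) 15]
  · have : (1 : ℝ) - 2 * 1 + 1 = 0 := by norm_num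
    rw [this, abs_zero]
    exact mul_nonneg (le_max_of_le_right (by norm_num)) (sq_nonneg τ)

omit hM in
/-- factorisation of `h_z` at a point into the `μ`-th factor and the rest. [cite: Balaban1984PropagatorsI, (1.118) p.36] -/
theorem hz_eq_mul_prod_erase (z : Cen M M₀) (u : TorR M) (μ : Fin d) :
    hz M M₀ z u = prof M M₀ μ (u.c μ / sp M M₀ μ - ((z μ).val : ℝ))
      * ∏ ν ∈ Finset.univ.erase μ, prof M M₀ ν (u.c ν / sp M M₀ ν - ((z ν).val : ℝ)) := by
  unfold hz
  exact (Finset.mul_prod_erase Finset.univ (fun ν => prof M M₀ ν (u.c ν / sp M M₀ ν - ((z ν).val : ℝ)))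
    (Finset.mem_univ μ)).symm

omit hM in
/-- the factors off the axis `μ` do not see a shift along `μ`. [cite: Balaban1984PropagatorsI, (1.118) p.36] -/
theorem prod_erase_shift (z : Cen M M₀) (u : TorR M) (μ : Fin d) (t : ℝ) :
    ∏ ν ∈ Finset.univ.erase μ, prof M M₀ ν ((shift M u μ t).c ν / sp M M₀ ν - ((z ν).val : ℝ))
      = ∏ ν ∈ Finset.univ.erase μ, prof M M₀ ν (u.c ν / sp M M₀ ν - ((z ν).val : ℝ)) := by
  refine Finset.prod_congr rfl fun ν hν => ?_
  rw [shift_c_of_ne M u (Finset.ne_of_mem_erase hν)]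

/-- **SECOND DIFFERENCES ALONG AN AXIS: `|h_z(u + te_μ) − 2h_z(u) + h_z(u − te_μ)| ≤ (4·max(sup|h″|,15)/M₀²)·t²`** — `Δh = O(M₀⁻²)`,
the `(Δh)A` term of (1.121), uniformly in the torus and in `M₀ ≥ 1`. [cite: Balaban1984PropagatorsI, (1.118) p.36 with (1.121) p.37] -/
theorem abs_hz_second_diff_le (hM₀ : 1 ≤ M₀) (z : Cen M M₀) (u : TorR M) (μ : Fin d) (t : ℝ) :
    |hz M M₀ z (shift M u μ t) - 2 * hz M M₀ z u + hz M M₀ z (shift M u μ (-t))|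
      ≤ 4 * max (D2 hprof) 15 / (M₀ : ℝ) ^ 2 * t ^ 2 := by
  have hM0 : (0 : ℝ) < M₀ := by exact_mod_cast hM₀
  have hs0 := sp_pos M M₀ μ
  rw [hz_eq_mul_prod_erase M z (shift M u μ t) μ, hz_eq_mul_prod_erase M z u μ,
    hz_eq_mul_prod_erase M z (shift M u μ (-t)) μ, prod_erase_shift, prod_erase_shift, shift_c_self, shift_c_self]
  set R := ∏ ν ∈ Finset.univ.erase μ, prof M M₀ ν (u.c ν / sp M M₀ ν - ((z ν).val : ℝ)) with hR
  have hR0 : 0 ≤ R := Finset.prod_nonneg fun ν _ => prof_nonneg M M₀ ν _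
  have hR1 : R ≤ 1 := Finset.prod_le_one (fun ν _ => prof_nonneg M M₀ ν _) fun ν _ => prof_le_one M M₀ ν _
  set a := u.c μ / sp M M₀ μ - ((z μ).val : ℝ) with ha
  set τ := t / sp M M₀ μ with hτ
  have e1 : (u.c μ + t) / sp M M₀ μ - ((z μ).val : ℝ) = a + τ := by rw [ha, hτ]; field_simp; ring
  have e2 : (u.c μ + -t) / sp M M₀ μ - ((z μ).val : ℝ) = a - τ := by rw [ha, hτ]; field_simp; ring
  rw [e1, e2]
  have key := abs_prof_second_diff_le M (M₀ := M₀) μ a τ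
  have hK0 : (0 : ℝ) ≤ max (D2 hprof) 15 := le_max_of_le_right (by norm_num)
  -- `τ² ≤ 4t²/M₀²` unless the axis carries one centre (then the second difference vanishes)
  rcases Nat.lt_or_ge (nCtr M M₀ μ) 2 with h1 | h2
  · have hc : ∀ s : ℝ, prof M M₀ μ s = 1 := fun s => by unfold prof; rw [if_neg (by omega)]
    rw [hc, hc, hc]
    have : (1 : ℝ) * R - 2 * (1 * R) + 1 * R = 0 := by ring
    rw [this, abs_zero]
    positivity
  · have hs := half_le_sp M hM₀ h2
    have hτ2 : τ ^ 2 ≤ 4 / (M₀ : ℝ) ^ 2 * t ^ 2 := by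
      rw [hτ, div_pow, div_mul_eq_mul_div, div_le_div_iff₀ (by positivity) (by positivity)]
      have : (M₀ : ℝ) ^ 2 ≤ 4 * sp M M₀ μ ^ 2 := by nlinarith
      nlinarith [sq_nonneg t]
    calc |prof M M₀ μ (a + τ) * R - 2 * (prof M M₀ μ a * R) + prof M M₀ μ (a - τ) * R|
        = |prof M M₀ μ (a + τ) - 2 * prof M M₀ μ a + prof M M₀ μ (a - τ)| * R := by
          rw [show prof M M₀ μ (a + τ) * R - 2 * (prof M M₀ μ a * R) + prof M M₀ μ (a - τ) * R
            = (prof M M₀ μ (a + τ) - 2 * prof M M₀ μ a + prof M M₀ μ (a - τ)) * R by ring, abs_mul, abs_of_nonneg hR0]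
      _ ≤ (max (D2 hprof) 15 * τ ^ 2) * 1 := mul_le_mul key hR1 hR0 (by positivity)
      _ ≤ max (D2 hprof) 15 * (4 / (M₀ : ℝ) ^ 2 * t ^ 2) := by rw [mul_one]; exact mul_le_mul_of_nonneg_left hτ2 hK0
      _ = 4 * max (D2 hprof) 15 / (M₀ : ℝ) ^ 2 * t ^ 2 := by ring

end Partition

end

end Literature.MathematicalPhysics.QuantumFieldTheory.Balaban1983to89.B5WalkPartitionTorus
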